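import Mathlib
import Literature.MathematicalPhysics.QuantumFieldTheory.Balaban1983to89.B10Assembly
import Literature.MathematicalPhysics.QuantumFieldTheory.Balaban1983to89.B16B10Shape

/-!
# `Balaban1983to89.B10DagLeaf` — the DAG leaf `b10` against the paper's own leaf system: from (62), (64), (1)
and three labelled reader's items, `¬ B10.Thm1Printed` for every `B10Assembly.LeafSystem` family containing
arbitrarily fine lattices, while `B10.Thm1PrintedCompact ∧ B10.Thm2Printed` holds (B10Assembly); plus an explicit
LeafSystem-carrying countermodel making the separation unconditional in the kernel

CITATION HEADER (lean-in-tree rule 2026-08-18).  Source: T. Bałaban, *Ultraviolet stability of three-dimensional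
lattice pure gauge field theories*, Commun. Math. Phys. **102**, 255–275 (1985), doi:10.1007/bf01229380, bib
`Balaban1985UV3` (cell paper B10; held `paper:balaban1985-cmp102-uv-stability-3d`, journal page = PDF page + 254).
The quotations below were READ AS IMAGES on the x2 page renders of the cell
(`run/shared/lean/pub/pub-balaban/b2b-balaban-ref1/pages/1985-cmp102-uv-stability-3d/…-p002-x2.png`, `…-p003-x2.png`,
`…-p006-x2.png`, `…-p017-x2.png`, `…-p019-x2.png` = pp. 256, 257, 260, 271, 273), not on an OCR layer:

* p. 256 [2], (1): *"ρ₀(U) = exp[−(1/g₀²)A(U) − E], (1) where U is a gauge field configuration on the torus T,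
  g₀² = g²ε^{4−d} = g²ε (d = 3), A(U) is the Wilson action, and E is a constant including normalization terms and
  vacuum energy renormalization counterterms. This constant can be defined perturbatively by a finite order expansion
  of the integral ∫dU (gauge fixing term) exp[−(1/g₀²)A(U)] with respect to g, but we prefer to give an inductive
  definition during the proof."*; same page: *"We terminate constructions of the densities ρ_k when we reach the unit
  lattice, or more exactly when L^kε = ε₀, where ε₀ is a positive constant depending on the coupling constant g only.
  Let us denote by K the index satisfying this equality, i.e. L^Kε = ε₀. Obviously K depends on ε and ε₀."*;
  (3)–(4): *"χ(U)e^{−O(1)|T_ε|} ≤ ρ_K(U) ≤ e^{O(1)|T_ε|}, |T_ε| = Σ_{x∈T_ε} ε³, (3) with a constant O(1) depending on g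
  and ε₀ only. The function χ(U) is a characteristic function of the domain |U(∂p) − 1| < ε₁, p ⊂ T₁^{(K)}, (4) where
  ε₁ is a sufficiently small positive constant, which will be chosen later. The constant O(1) goes to ∞ as g → 0. To
  get a better bound we have to write explicitly the expression divergent with g."*; (5): *"Thus the ultraviolet
  stability for the flow means the sequence of bounds χ(U)exp[−(1/g_k²)A^η(U_k(U)) − O(1)|T₁^{(k)}|] ≤ ρ_k(U) ≤
  exp O(1)|T₁^{(k)}|, (5) where U_k(U) is the minimal configuration constructed in [7] and determined by the
  configuration U on T₁^{(k)}, and satisfying (4), A^η(U_k(U)) = Σ_{p⊂T_η} η⁻¹[1 − Re tr U_k(U,∂p)], η = L^{−k},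
  g_k = g(L^kε)^{1/2}, |T₁^{(k)}| = Σ_{y∈T₁^{(k)}} 1 = Σ_{x∈T_η} η³ = (L^kε)^{−3}|T_ε|,"* continued p. 257 [3] l. 1:
  *"and the constant O(1) is independent of ε, k, g_k in a bounded set."*, then **Theorem 1** (p. 257): *"The lattice
  approximations of the three-dimensional pure Yang–Mills theory with a semi-simple compact group Lie G are ultraviolet
  stable in the sense that the sequence of densities ρ_k, constructed by the inductive definition (2), with ρ₀ given by
  (1), satisfies the bounds (5)."* — typed verbatim by unit r2 as `B10.Thm1Printed` (one constant per bounded coupling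
  set `(0, gmax]`, all runs, all k) and, in the cell's audit reading (compact coupling window), as
  `B10.Thm1PrintedCompact` (cell GAPS G-B10-01).
* p. 260 [6], after (18): *"where χ = Π_{b∈Ω₁} χ({|A(b)| < g₀p²(g₀)}), g₀ sufficiently small, and |Ω₁*| denotes the
  number of bonds belonging to Ω₁ minus the number of bonds in Ω₁^{(1)} and minus the number of bonds in the axial gauge
  fixing set."* and, same page: *"To write the integrals (13) in terms of the variables A′ we express the Haar measure
  dU′ as dU′ = σ(A′)dA′ = σ₀ σ/σ₀ (A′)dA′, σ₀ = σ(0), where dA′ is the Lebesque measure on 𝔤"*; p. 261 [7], (22):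
  *"d(𝔤) denotes a dimension of the Lie algebra 𝔤"* (located by gen 1 in `B10Assembly.Consts`).
* p. 271 [17]: *"The constant E_{k+1} is defined as E_{k+1} = E_k − E^{(k)}, where E^{(k)} = log σ₀|T₁^{(k)*}| +
  d(𝔤) log g_k|T₁^{(k)*}| + log Z^{(k)}(T₁^{(k)}, 1) + Σ_X 𝒫′_{k+1}(g_k, X, 1). (62)"* (typed by gen 1 as the step
  leaf `B10SectAGathering.Estep62`, field `StepLeaves.estep62` of `B10Assembly.LeafSystem.steps`).
* p. 273 [19]: *"E_k = Σ_{j=k}^{K−1} E^{(j)}, (64) where E^{(j)} is defined by (62). From (25), which holds for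
  arbitrary j, we get easily |E^{(j)}| ≤ O(1)|T₁^{(j)}|, hence |E_k| ≤ Σ_{k=k}^{K−1} O(1)|T₁^{(j)}| = Σ_{j=k}^{K−1}
  O(1)L^{−3(j−k)}|T₁^{(k)}| ≤ O(1)|T₁^{(k)}|. (65)"* ((64) with E₀ = E is the carrier field `B10.TowerRun.Ecst_eq`).

WHAT THIS MODULE DOES (audit cell `pub-balaban`, paper sub-cell B10, unit `b2b-balaban-b10-g10` = gen 10 of the
b10 lineage, owner of `B10Assembly`; journal row `G-B10-01-DAGLEAF`; value = TYPED SKELETON / KERNEL BOOKKEEPING at the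
cell's DAG boundary, NOT summit progress; nothing of the series is asserted).  Gen 1 of the sub-cell proved
`B10Assembly.thm1Compact_and_thm2_of_leafSystem`: every family of runs carrying leaf systems with common constants
satisfies `B10.Thm1PrintedCompact ∧ B10.Thm2Printed`, and recorded (GAPS G-B10-01, prose) that the ONE-SIDED reading
`B10.Thm1Printed` — the first conjunct of the cell's DAG leaf `DagBinding.b10 := B10.Thm1Printed runs10 ∧ B10.Thm2Printed
runs10` — is not derivable from the printed leaves, because E^{(k)} of (62) carries `d(𝔤) log g_k|T₁^{(k)*}|`.  The
sibling `B16B10Shape` (surge unit pv24) made the k = 0 check kernel over the statement carrier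
(`B16B10Shape.b10_O1_lower_of_bounds5At_zero`: a step-0 configuration with `ρ₀ ≥ exp((c log g₀⁻¹ − C₀)|T₁^{(0)}|)` forces
`c log g₀⁻¹ − C₀ ≤ O(1)` in (5) at k = 0) and derived that hypothesis from located leaves for the d = 4 series (§4 there,
`B16SmallCouplings`).  This module is the d = 3 twin OVER GEN 1's OWN CARRIER `B10Assembly.LeafSystem`:

* §1 — THREE READER'S ITEMS, labelled as such and carried as HYPOTHESES (never as cited facts): (R1) `UnitConfig0`:
  the unit configuration U ≡ 1 is a level-0 configuration with A(1) = 0 and χ(1) = 1 ((1), (4), (5) p. 256: every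
  plaquette variable of U ≡ 1 equals 1, and A = Σ_p[1 − Re tr U(∂p)]); (R2) `StarLower S s₀`: the whole-lattice count
  of p. 260, `|T₁^{(k)*}| ≥ s₀|T₁^{(k)}|` — for Ω₁ = the whole unit 3-torus with N sites: 3N bonds, minus the 3N/L³ bonds
  of the L-lattice, minus the N − N/L³ bonds of the axial gauge (a maximal tree in each of the N/L³ blocks), i.e.
  |T₁^{(k)*}| = 2(1 − L⁻³)|T₁^{(k)}|, so s₀ = 2(1 − L⁻³) (the theorems need only s₀ > 0; gen 1 typed the UPPER count
  `starT_le : |T₁^{(k)*}| ≤ 3|T₁^{(k)}|` only); (R3) `DgLower S d₀`: `d(𝔤) ≥ d₀` with d₀ > 0 (Theorem 1: G semi-simple,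
  so d(𝔤) ≥ 3; gen 1's `StepPieces.dg` is a per-step real with `0 ≤ dg ≤ C.dg` only).
* §2 — REAL ARITHMETIC on the located leaves of one run `S : LeafSystem C T`: from `estep62` ((62)), `g_k ≤ 1`
  (`g_le_one`, so `d(𝔤) log g_k⁻¹|T₁^{(k)*}| ≥ 0` at every step) and the (L5) inputs `logσ₀_le`, `logZT_le`, `PprT_le`,
  `starT_le`: `−E^{(j)} ≥ d(𝔤) log g_j⁻¹|T₁^{(j)*}| − a₁|T₁^{(j)}|` (`negEstep_lower`, a₁ = 3σmax + z + aP of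
  `B10Assembly.a₁`); with (R2), (R3) at j = 0 and the geometric site sum `Σ_{j<K}|T₁^{(j)}| ≤ |T₁^{(0)}|/(1 − L⁻³)`
  (`sum_sites_le`, from `sites_eq`): **`−E = −E₀ ≥ (d₀s₀ log g₀⁻¹ − a₁/(1 − L⁻³))|T₁^{(0)}|`** for K ≥ 1
  (`negEcst_zero_lower`; (64): E₀ = Σ_{j<K} E^{(j)}, `TowerRun.Ecst_eq`).
* §3 — (1) AT THE UNIT CONFIGURATION: the leaf `step0` ((47)₀ = (1) p. 256), `noInt0` (no interaction terms at k = 0),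
  `Rm_zero` and the carrier identity `mainT_triv` give `ρ₀(1) ≥ e^{−E}` under (R1) (`rho_zero_lower`), hence the
  step-0 logarithm `∃ U₁, ρ₀(U₁) ≥ exp((d₀s₀ log g₀⁻¹ − a₁/(1 − L⁻³))|T₁^{(0)}|)` (`unitConfigLog_of_leafSystem`) and, BY
  NAME through `B16B10Shape.b10_O1_lower_of_bounds5At_zero`, **any constant O(1) serving (5) at k = 0 satisfies
  `O(1) ≥ d₀s₀ log g₀⁻¹ − a₁/(1 − L⁻³)`** (`O1_lower_of_bounds5At_zero`) — the lower companion of gen 1's upper display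
  `B10Assembly.O1` (whose window term is `3·dg·max|log g|/(1 − L⁻³)`): on the leaf system the constant of (5) at the
  bare scale is pinned between two multiples of `d(𝔤) log g₀⁻¹`.
* §4 — FAMILIES: if a LeafSystem family with common constants satisfies (R1)–(R3) and contains runs with at least one
  step, non-empty lattice and ARBITRARILY SMALL BARE COUPLING g₀ = gε^{1/2} (`SmallBareOccur`; from arbitrarily fine
  lattices, `smallBare_of_fineLattices` — p. 256: g fixed, ε → 0 is the continuum limit the paper is about), then
  **`¬ B10.Thm1Printed`** (`not_thm1Printed_of_leafSystems`), hence the DAG leaf's conjunction fails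
  (`not_dagLeaf_b10_of_leafSystems`: `¬ (B10.Thm1Printed runs ∧ B10.Thm2Printed runs)`, the literal shape of
  `DagBinding.RefBinding.b10`, which this module does NOT import so that the carver's files may import it), while
  `B10.Thm1PrintedCompact runs ∧ B10.Thm2Printed runs` holds for the same family by gen 1
  (`compact_thm2_not_thm1Printed`).
* §5 — THE SEPARATION IS WITNESSED (no hypothesis left): the family `logRun K` (K : ℕ; the trivial run of
  `B10Assembly.trivRun` with d(𝔤) = 3, |T₁^{(k)*}| = (7/4)|T₁^{(k)}| = 2(1 − 2⁻³)|T₁^{(k)}|, E^{(k)} given by (62),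
  E_k by (64), ρ_k ≡ e^{−E_k}, spacing ε = 2^{−K}) carries a leaf system for the constants `logConsts` at every K
  (`logLeafSystem`) and satisfies (R1)–(R3) and `SmallBareOccur`; hence **`B10.Thm1PrintedCompact ∧ B10.Thm2Printed ∧
  ¬ B10.Thm1Printed` on one LeafSystem family** (`logRun_separation`), i.e. the hypothesis bundle of `B10Assembly` does
  NOT yield `B10.Thm1Printed` (`leafSystems_not_thm1Printed`), and the converse of `B10.thm1Compact_of_thm1Printed` fails
  on a family with couplings in (0, 1] (`not_thm1Printed_of_thm1Compact`).  A consistency statement about the TYPING —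
  which conjunct of the DAG leaf the paper's bookkeeping can and cannot deliver — not a statement about Yang–Mills.

WHAT IS NOT CLAIMED.  Nothing about Bałaban's densities: whether the true ρ_k of (1)–(2) carry a `LeafSystem` (with the
g-INDEPENDENT volume bounds `logZT_le`, `PprT_le` of p. 273's «we get easily») is exactly the audit question of the
series; (R1)–(R3) are elementary but are hypotheses here, not cited facts; the per-level analogue (O(1) of (5) at level
k ≥ d₀s₀ log g_k⁻¹ − const, needing the unit configuration at level k and the interaction/remainder volume bounds) is
not typed.  Cell records: GAPS.md G-B10-01 (UPDATE: kernel form at the DAG boundary), C-b10g10-1; DIVERGENCE.md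
D-b10.14 (the typing of (R1)–(R3) and of "fine lattices"); NOTE → carver (leaf `b10`'s first conjunct vs
`Thm1PrintedCompact`); CLAIMS.log `G-B10-01-DAGLEAF`; HANDOFF.md § b2b-balaban-b10 gen 10.
-/

namespace Literature.MathematicalPhysics.QuantumFieldTheory.Balaban1983to89

namespace B10DagLeaf

open B10 B10Assembly B10SectAGathering
open B10LargeField (NoInteraction0)
open B16B10Shape (b10_O1_lower_of_bounds5At_zero)

/-! ## §1. The three reader's items (hypotheses, labelled) -/

section Readers

variable {C : B10Assembly.Consts} {T : TowerRun}

/-- READER'S ITEM (R1): the unit configuration at level 0.  (1) p. 256 [2] «U is a gauge field configuration on the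
torus T», (5) «A^η(U_k(U)) = Σ_{p⊂T_η} η⁻¹[1 − Re tr U_k(U,∂p)]», (4) «|U(∂p) − 1| < ε₁»: at U ≡ 1 every plaquette
variable is 1, so the (background) Wilson action vanishes and the small-field characteristic function is 1.  Typed over
the abstract carrier as: some level-0 configuration has `wilsonBG 0 U = 0` and `χ 0 U = 1`.  A hypothesis (the carrier
only NAMES configurations), never a cited fact. [cite: Balaban1985UV3, (1) + (4) + (5) p.256] -/
def UnitConfig0 (T : TowerRun) : Prop :=
  ∃ U : T.Cfg 0, T.wilsonBG 0 U = 0 ∧ T.χ 0 U = 1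

/-- READER'S ITEM (R2): a LOWER count of the starred bonds of the whole lattice, `s₀|T₁^{(k)}| ≤ |T₁^{(k)*}|` at every
step k < K.  p. 260 [6]: «|Ω₁*| denotes the number of bonds belonging to Ω₁ minus the number of bonds in Ω₁^{(1)} and
minus the number of bonds in the axial gauge fixing set.» — for Ω₁ = the whole unit 3-torus with N = |T₁^{(k)}| sites:
3N − 3N/L³ − (N − N/L³) = 2(1 − L⁻³)N, so the count gives s₀ = 2(1 − L⁻³); gen 1 typed only the upper count
`LeafSystem.starT_le` (≤ 3N).  A hypothesis on the leaf system's step pieces. [cite: Balaban1985UV3, (18) p.260] -/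
def StarLower (S : LeafSystem C T) (s₀ : ℝ) : Prop :=
  ∀ (k : ℕ) (hk : k + 1 ≤ T.K), s₀ * T.sites k ≤ (S.steps k hk).P.starT

/-- READER'S ITEM (R3): `d(𝔤) ≥ d₀` at every step ((22) p. 261 [7] «d(𝔤) denotes a dimension of the Lie algebra 𝔤»;
Theorem 1 p. 257: G semi-simple compact, so d(𝔤) ≥ 3; gen 1's `StepPieces.dg` is a per-step real with `0 ≤ dg ≤ C.dg`
only).  A hypothesis. [cite: Balaban1985UV3, (22) p.261] -/
def DgLower (S : LeafSystem C T) (d₀ : ℝ) : Prop :=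
  ∀ (k : ℕ) (hk : k + 1 ≤ T.K), d₀ ≤ (S.steps k hk).P.dg

end Readers

/-! ## §2. Real arithmetic on the located leaves: −E^{(j)} and −E₀ from below -/

section Arithmetic

variable {C : B10Assembly.Consts} {T : TowerRun}

/-- **(62) from below**, per step: from the leaf `estep62` («E^{(k)} = log σ₀|T₁^{(k)*}| + d(𝔤) log g_k|T₁^{(k)*}| +
log Z^{(k)}(T₁^{(k)}, 1) + Σ_X 𝒫′_{k+1}(g_k, X, 1)», p. 271 [17]) and the (L5) inputs of the leaf system
(`|log σ₀| ≤ σmax`, `0 ≤ |T₁*| ≤ 3|T₁|`, `|log Z(T, 1)| ≤ z|T₁|`, `|Σ_X 𝒫′| ≤ aP|T₁|`):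
`−E^{(j)} ≥ d(𝔤)·log g_j⁻¹·|T₁^{(j)*}| − a₁|T₁^{(j)}|`, a₁ = 3σmax + z + aP (`B10Assembly.a₁`).  Re-derived real
arithmetic, kernel-checked. [cite: Balaban1985UV3, (62) p.271] -/
theorem negEstep_lower (S : LeafSystem C T) (j : ℕ) (hj : j + 1 ≤ T.K) :
    (S.steps j hj).P.dg * Real.log (T.g j)⁻¹ * (S.steps j hj).P.starT - a₁ C * T.sites j ≤ -T.Estep j := by
  have hE : T.Estep j = ((S.steps j hj).P.logσ₀ + (S.steps j hj).P.dg * Real.log (T.g j))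
      * (S.steps j hj).P.starT + (S.steps j hj).P.logZT + (S.steps j hj).P.PprT := (S.steps j hj).estep62
  have h1 := S.logσ₀_le j hj
  have h2 := S.logZT_le j hj
  have h3 := S.PprT_le j hj
  have h4 := S.starT_nonneg j hj
  have h5 := S.starT_le j hj
  have ha : (S.steps j hj).P.logσ₀ * (S.steps j hj).P.starT ≤ C.σmax * (3 * T.sites j) :=
    calc (S.steps j hj).P.logσ₀ * (S.steps j hj).P.starT
        ≤ |(S.steps j hj).P.logσ₀| * (S.steps j hj).P.starT := mul_le_mul_of_nonneg_right (le_abs_self _) h4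
      _ ≤ C.σmax * (S.steps j hj).P.starT := mul_le_mul_of_nonneg_right h1 h4
      _ ≤ C.σmax * (3 * T.sites j) := mul_le_mul_of_nonneg_left h5 C.σmax_nonneg
  have hb : (S.steps j hj).P.logZT ≤ C.z * T.sites j := (le_abs_self _).trans h2
  have hc : (S.steps j hj).P.PprT ≤ C.aP * T.sites j := (le_abs_self _).trans h3
  rw [hE, Real.log_inv]
  unfold a₁
  linarith

/-- The volume-only form: `−E^{(j)} ≥ −a₁|T₁^{(j)}|` for every j < K (the d(𝔤)-term is ≥ 0 because `0 < g_j ≤ 1`,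
`d(𝔤) ≥ 0`, `|T₁*| ≥ 0`).  Re-derived. [cite: Balaban1985UV3, (62) p.271] -/
theorem negEstep_lower_vol (S : LeafSystem C T) (j : ℕ) (hj : j + 1 ≤ T.K) :
    -(a₁ C * T.sites j) ≤ -T.Estep j := by
  have h := negEstep_lower S j hj
  have hlog : 0 ≤ Real.log (T.g j)⁻¹ := log_inv_nonneg_of_le_one (S.g_pos j) (S.g_le_one j (by omega))
  have hnn : 0 ≤ (S.steps j hj).P.dg * Real.log (T.g j)⁻¹ * (S.steps j hj).P.starT :=
    mul_nonneg (mul_nonneg (S.steps j hj).P.dg_nonneg hlog) (S.starT_nonneg j hj)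
  linarith

/-- With the reader's items (R2), (R3) at the bare scale: `−E^{(0)} ≥ (d₀s₀ log g₀⁻¹ − a₁)|T₁^{(0)}|` (K ≥ 1, d₀ ≥ 0).
Re-derived. [cite: Balaban1985UV3, (62) p.271] -/
theorem negEstep_zero_lower (S : LeafSystem C T) {d₀ s₀ : ℝ} (hS : StarLower S s₀) (hD : DgLower S d₀)
    (hd : 0 ≤ d₀) (hK : 1 ≤ T.K) :
    (d₀ * s₀ * Real.log (T.g 0)⁻¹ - a₁ C) * T.sites 0 ≤ -T.Estep 0 := by
  have h1 : 0 + 1 ≤ T.K := by omega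
  have h := negEstep_lower S 0 h1
  have hlog : 0 ≤ Real.log (T.g 0)⁻¹ := log_inv_nonneg_of_le_one (S.g_pos 0) (S.g_le_one 0 (Nat.zero_le _))
  have hstar := S.starT_nonneg 0 h1
  have e1 : d₀ * Real.log (T.g 0)⁻¹ * (S.steps 0 h1).P.starT
      ≤ (S.steps 0 h1).P.dg * Real.log (T.g 0)⁻¹ * (S.steps 0 h1).P.starT :=
    mul_le_mul_of_nonneg_right (mul_le_mul_of_nonneg_right (hD 0 h1) hlog) hstar
  have e2 : d₀ * Real.log (T.g 0)⁻¹ * (s₀ * T.sites 0) ≤ d₀ * Real.log (T.g 0)⁻¹ * (S.steps 0 h1).P.starT :=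
    mul_le_mul_of_nonneg_left (hS 0 h1) (mul_nonneg hd hlog)
  linarith

/-- The geometric site sum behind (65) («Σ_{j=k}^{K−1} O(1)L^{−3(j−k)}|T₁^{(k)}| ≤ O(1)|T₁^{(k)}|», p. 273 [19]) at k = 0:
`Σ_{j<n} |T₁^{(j)}| ≤ |T₁^{(0)}|/(1 − L⁻³)` for every n, from `|T₁^{(j)}| = L^{−3j}|T₁^{(0)}|` (`sites_eq`,
`B10.sitesRun_shift`).  Re-derived. [cite: Balaban1985UV3, (65) p.273] -/
theorem sum_sites_le (S : LeafSystem C T) (n : ℕ) :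
    ∑ j ∈ Finset.range n, T.sites j ≤ T.sites 0 / (1 - (C.L ^ 3)⁻¹) := by
  have hL : 1 < C.L := C.one_lt_L
  have hr0 : 0 ≤ (C.L ^ 3)⁻¹ := by positivity
  have hr1 : (C.L ^ 3)⁻¹ < 1 := inv_lt_one_of_one_lt₀ (one_lt_pow₀ hL (by norm_num))
  have hs0 : 0 ≤ T.sites 0 := T.sites_nonneg 0
  have hshift : ∀ j, T.sites j = ((C.L ^ 3)⁻¹) ^ j * T.sites 0 := by
    intro j
    rw [S.sites_eq, S.sites_eq, show j = 0 + j from (Nat.zero_add j).symm, sitesRun_shift, Nat.zero_add]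
  have hgeo : ∑ j ∈ Finset.range n, ((C.L ^ 3)⁻¹) ^ j ≤ (1 - (C.L ^ 3)⁻¹)⁻¹ :=
    calc ∑ j ∈ Finset.range n, ((C.L ^ 3)⁻¹) ^ j ≤ ∑' j, ((C.L ^ 3)⁻¹) ^ j :=
          (summable_geometric_of_lt_one hr0 hr1).sum_le_tsum _ (fun i _ => pow_nonneg hr0 i)
      _ = (1 - (C.L ^ 3)⁻¹)⁻¹ := tsum_geometric_of_lt_one hr0 hr1
  calc ∑ j ∈ Finset.range n, T.sites j
      = (∑ j ∈ Finset.range n, ((C.L ^ 3)⁻¹) ^ j) * T.sites 0 := by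
        rw [Finset.sum_mul]; exact Finset.sum_congr rfl (fun j _ => hshift j)
    _ ≤ (1 - (C.L ^ 3)⁻¹)⁻¹ * T.sites 0 := mul_le_mul_of_nonneg_right hgeo hs0
    _ = T.sites 0 / (1 - (C.L ^ 3)⁻¹) := by rw [div_eq_mul_inv, mul_comm]

/-- **(62) + (64) from below at the bare scale**: for a run with at least one step carrying a leaf system and the
reader's items (R2), (R3), `−E = −E₀ ≥ (d₀s₀ log g₀⁻¹ − a₁/(1 − L⁻³))|T₁^{(0)}|` ((64) p. 273 [19]: E₀ = Σ_{j<K}E^{(j)},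
carrier field `TowerRun.Ecst_eq`; j = 0 by `negEstep_zero_lower`, j ≥ 1 by `negEstep_lower_vol`, the site sum by
`sum_sites_le`).  This is the located content behind the prose of cell GAPS G-B10-01 («−E ≥ 3d(𝔤)|T₁^{(0)}| log g₀⁻¹ −
O(1)|T₁^{(0)}|»), with the coefficient made honest (s₀d₀, s₀ = 2(1 − L⁻³) by the count of (R2)).  Re-derived real
arithmetic, kernel-checked. [cite: Balaban1985UV3, (62) p.271 + (64) p.273] -/
theorem negEcst_zero_lower (S : LeafSystem C T) {d₀ s₀ : ℝ} (hS : StarLower S s₀) (hD : DgLower S d₀)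
    (hd : 0 ≤ d₀) (hK : 1 ≤ T.K) :
    (d₀ * s₀ * Real.log (T.g 0)⁻¹ - a₁ C / (1 - (C.L ^ 3)⁻¹)) * T.sites 0 ≤ -T.Ecst 0 := by
  obtain ⟨K', hK'⟩ : ∃ K', T.K = K' + 1 := ⟨T.K - 1, by omega⟩
  have hsum : T.Ecst 0 = T.Estep 0 + ∑ i ∈ Finset.range K', T.Estep (i + 1) := by
    rw [T.Ecst_eq 0, Nat.Ico_zero_eq_range, hK', Finset.sum_range_succ']
    ring
  have hsites : ∑ j ∈ Finset.range T.K, T.sites j = T.sites 0 + ∑ i ∈ Finset.range K', T.sites (i + 1) := by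
    rw [hK', Finset.sum_range_succ']
    ring
  have hb : ∀ i ∈ Finset.range K', T.Estep (i + 1) ≤ a₁ C * T.sites (i + 1) := by
    intro i hi
    rw [Finset.mem_range] at hi
    have := negEstep_lower_vol S (i + 1) (by omega)
    linarith
  have hB : ∑ i ∈ Finset.range K', T.Estep (i + 1) ≤ a₁ C * ∑ i ∈ Finset.range K', T.sites (i + 1) := by
    rw [Finset.mul_sum]
    exact Finset.sum_le_sum hb
  have h0 := negEstep_zero_lower S hS hD hd hK
  have hgeo := sum_sites_le S T.K
  have ha1 : 0 ≤ a₁ C := a₁_nonneg C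
  have hmul : a₁ C * ∑ j ∈ Finset.range T.K, T.sites j ≤ a₁ C * (T.sites 0 / (1 - (C.L ^ 3)⁻¹)) :=
    mul_le_mul_of_nonneg_left hgeo ha1
  rw [hsites] at hmul
  have hring : a₁ C / (1 - (C.L ^ 3)⁻¹) * T.sites 0 = a₁ C * (T.sites 0 / (1 - (C.L ^ 3)⁻¹)) := by ring
  rw [hsum]
  nlinarith [hB, h0, hmul, hring]

end Arithmetic

/-! ## §3. (1) at the unit configuration: ρ₀(1) ≥ e^{−E}, the step-0 logarithm, the lower bound on the O(1) of (5) -/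

section StepZero

variable {C : B10Assembly.Consts} {T : TowerRun}

/-- **ρ₀(1) ≥ e^{−E}** from the leaves: (1) p. 256 [2] «ρ₀(U) = exp[−(1/g₀²)A(U) − E]» is carried by the leaf system
as (47)₀ (`LeafSystem.step0`) with no interaction terms (`noInt0`) and no remainder (`Rm_zero`) at k = 0; at a
configuration with A = 0, χ = 1 (reader's item (R1)) the main term vanishes (`TowerRun.mainT_triv`), so
`ρ₀(U₁) ≥ exp(−E₀ − Rm₀) ≥ exp(−E₀)`.  Re-derived bookkeeping. [cite: Balaban1985UV3, (1) p.256 + (47) p.267] -/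
theorem rho_zero_lower (S : LeafSystem C T) (hU : UnitConfig0 T) :
    ∃ U₁ : T.Cfg 0, Real.exp (-T.Ecst 0) ≤ T.ρ 0 U₁ := by
  obtain ⟨U, hA, hχ⟩ := hU
  refine ⟨U, ?_⟩
  have h47 := S.step0.2 U
  have hm : T.mainT 0 (T.triv 0) U = 0 := by rw [T.mainT_triv, hA, mul_zero]
  have hP : T.Pint 0 (T.triv 0) U = 0 := S.noInt0 (T.triv 0) U
  rw [hχ, hm, hP, one_mul] at h47
  refine le_trans (Real.exp_le_exp.mpr ?_) h47
  linarith [S.Rm_zero]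

/-- **The step-0 logarithm from the leaves** (the hypothesis `hlog` of `B16B10Shape.b10_O1_lower_of_bounds5At_zero`,
here DERIVED): under (R1)–(R3) and K ≥ 1, some level-0 configuration has
`ρ₀(U₁) ≥ exp((d₀s₀ log g₀⁻¹ − a₁/(1 − L⁻³))|T₁^{(0)}|)`.  Re-derived (`rho_zero_lower` + `negEcst_zero_lower`).
[cite: Balaban1985UV3, (1) p.256 + (62) p.271 + (64) p.273] -/
theorem unitConfigLog_of_leafSystem (S : LeafSystem C T) {d₀ s₀ : ℝ} (hU : UnitConfig0 T) (hS : StarLower S s₀)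
    (hD : DgLower S d₀) (hd : 0 ≤ d₀) (hK : 1 ≤ T.K) :
    ∃ U₁ : T.Cfg 0,
      Real.exp ((d₀ * s₀ * Real.log (T.g 0)⁻¹ - a₁ C / (1 - (C.L ^ 3)⁻¹)) * T.sites 0) ≤ T.ρ 0 U₁ := by
  obtain ⟨U₁, h⟩ := rho_zero_lower S hU
  exact ⟨U₁, (Real.exp_le_exp.mpr (negEcst_zero_lower S hS hD hd hK)).trans h⟩

/-- **THE O(1) OF (5) AT k = 0 IS AT LEAST `d₀s₀ log g₀⁻¹ − a₁/(1 − L⁻³)`** (cell GAPS G-B10-01 made kernel on the leaf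
system): if a constant `O1` serves the bounds (5) at step 0 of a run carrying a leaf system with (R1)–(R3), K ≥ 1 and
|T₁^{(0)}| > 0, then `d₀s₀ log g₀⁻¹ − a₁/(1 − L⁻³) ≤ O1` — BY NAME through `B16B10Shape.b10_O1_lower_of_bounds5At_zero`
(the upper half of (5) at the configuration of `unitConfigLog_of_leafSystem`).  The lower companion of gen 1's display
`B10Assembly.O1 C gmin gmax ∋ 3·dg·max(|log gmin|, |log gmax|)/(1 − L⁻³)`: the true dependence of (5)'s constant on
the coupling at the bare scale is logarithmic, p. 256 «The constant O(1) goes to ∞ as g → 0» quantified.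
Re-derived bookkeeping. [cite: Balaban1985UV3, (5) p.256 + (62) p.271] -/
theorem O1_lower_of_bounds5At_zero (S : LeafSystem C T) {d₀ s₀ : ℝ} (hU : UnitConfig0 T) (hS : StarLower S s₀)
    (hD : DgLower S d₀) (hd : 0 ≤ d₀) (hK : 1 ≤ T.K) (hN : 0 < T.sites 0) {O1 : ℝ}
    (h5 : Bounds5At T.toRunData O1 0) :
    d₀ * s₀ * Real.log (T.g 0)⁻¹ - a₁ C / (1 - (C.L ^ 3)⁻¹) ≤ O1 :=
  b10_O1_lower_of_bounds5At_zero T.toRunData (d₀ * s₀) (a₁ C / (1 - (C.L ^ 3)⁻¹)) O1 hN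
    (unitConfigLog_of_leafSystem S hU hS hD hd hK) h5

end StepZero

/-! ## §4. Families: fine lattices ⇒ ¬ Theorem 1 (one-sided reading), the DAG-leaf conjunction, the compact reading -/

section Families

variable {C : B10Assembly.Consts} {I : Type}

/-- "Arbitrarily small bare couplings occur among the runs with at least one step and a non-empty lattice":
∀ δ > 0 ∃ i, K_i ≥ 1 ∧ |T₁^{(0)}|_i > 0 ∧ g_{i,0} < δ.  With p. 256 [2] «g₀² = g²ε (d = 3)», «g_k = g(L^kε)^{1/2}» and the
bare coupling g FIXED for the family (`B10Assembly.Consts.g`), this is "arbitrarily fine lattices occur"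
(`smallBare_of_fineLattices`).  A hypothesis on the family (which runs it contains), not a cited fact. [cite: Balaban1985UV3, (1) + (5) p.256] -/
def SmallBareOccur (T : I → TowerRun) : Prop :=
  ∀ δ : ℝ, 0 < δ → ∃ i, 1 ≤ (T i).K ∧ 0 < (T i).sites 0 ∧ (T i).g 0 < δ

/-- "Arbitrarily fine lattices occur": ∀ δ > 0 ∃ i, K_i ≥ 1 ∧ |T_ε|_i > 0 ∧ ε_i < δ (p. 256 [2]: «The ultraviolet stability
means that the actions ρ_K have bounds independent of the lattice spacing ε»; «Let us denote by K the index satisfying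
this equality, i.e. L^Kε = ε₀», so ε < ε₀ forces K ≥ 1).  A hypothesis on the family. [cite: Balaban1985UV3, (3) p.256] -/
def FineLattices {T : I → TowerRun} (S : ∀ i, LeafSystem C (T i)) : Prop :=
  ∀ δ : ℝ, 0 < δ → ∃ i, 1 ≤ (T i).K ∧ 0 < (S i).Tε ∧ (S i).ε < δ

/-- Fine lattices give small bare couplings and non-empty unit lattices: `g₀ = g·ε^{1/2}`, `|T₁^{(0)}| = ε⁻³|T_ε|`
(`LeafSystem.g_eq`, `sites_eq`; `B10.gRun`, `B10.sitesRun`).  Elementary. [folklore] -/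
theorem smallBare_of_fineLattices {T : I → TowerRun} (S : ∀ i, LeafSystem C (T i)) (h : FineLattices S) :
    SmallBareOccur T := by
  intro δ hδ
  have hg : 0 < C.g := C.g_pos
  obtain ⟨i, hK, hT, hε⟩ := h ((δ / C.g) ^ 2) (by positivity)
  refine ⟨i, hK, ?_, ?_⟩
  · rw [(S i).sites_eq]
    unfold sitesRun
    have := (S i).ε_pos
    positivity
  · rw [(S i).g_eq]
    unfold gRun
    rw [pow_zero, one_mul]
    have hsq : Real.sqrt (S i).ε < δ / C.g :=
      calc Real.sqrt (S i).ε < Real.sqrt ((δ / C.g) ^ 2) := Real.sqrt_lt_sqrt (S i).ε_pos.le hε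
        _ = δ / C.g := Real.sqrt_sq (by positivity)
    calc C.g * Real.sqrt (S i).ε < C.g * (δ / C.g) := mul_lt_mul_of_pos_left hsq hg
      _ = δ := by field_simp

/-- **¬ THEOREM 1 IN THE ONE-SIDED (VERBATIM) READING, on the paper's own leaf system**: a family of runs carrying leaf
systems with common constants (`B10Assembly.LeafSystem`), the reader's items (R1)–(R3) with d₀, s₀ > 0, and arbitrarily
small bare couplings among its runs with K ≥ 1, |T₁^{(0)}| > 0, does NOT satisfy `B10.Thm1Printed` (p. 257 [3] Theorem 1
with «the constant O(1) is independent of ε, k, g_k in a bounded set» read as one constant per bounded coupling set):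
take gmax = 1 (the leaf system has 0 < g_k ≤ 1), get O1; at a run with `d₀s₀ log g₀⁻¹ > O1 + a₁/(1 − L⁻³)` the upper
bound of (5) at k = 0 fails at the unit configuration (`O1_lower_of_bounds5At_zero`).  Bookkeeping over located leaves
and labelled reader's items; NOT a statement about Bałaban's densities until a leaf system is instantiated on them.
[cite: Balaban1985UV3, Thm 1 p.257] -/
theorem not_thm1Printed_of_leafSystems (T : I → TowerRun) (S : ∀ i, LeafSystem C (T i)) {d₀ s₀ : ℝ}
    (hd : 0 < d₀) (hs : 0 < s₀) (hU : ∀ i, UnitConfig0 (T i)) (hS : ∀ i, StarLower (S i) s₀)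
    (hD : ∀ i, DgLower (S i) d₀) (hsmall : SmallBareOccur T) :
    ¬ Thm1Printed (fun i => (T i).toRunData) := by
  intro h
  obtain ⟨O1, hO1⟩ := h 1 one_pos
  have hc : 0 < d₀ * s₀ := mul_pos hd hs
  obtain ⟨i, hK, hN, hg⟩ :=
    hsmall (Real.exp (-((O1 + a₁ C / (1 - (C.L ^ 3)⁻¹) + 1) / (d₀ * s₀)))) (Real.exp_pos _)
  have h5 : Bounds5 (T i).toRunData O1 := hO1 i (fun k hk => ⟨(S i).g_pos k, (S i).g_le_one k hk⟩)
  have h50 : Bounds5At (T i).toRunData O1 0 := (bounds5_iff _ _).mp h5 0 (Nat.zero_le _)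
  have hO : d₀ * s₀ * Real.log ((T i).g 0)⁻¹ - a₁ C / (1 - (C.L ^ 3)⁻¹) ≤ O1 :=
    O1_lower_of_bounds5At_zero (S i) (hU i) (hS i) (hD i) hd.le hK hN h50
  have hg0 : 0 < (T i).g 0 := (S i).g_pos 0
  have hlt : Real.log ((T i).g 0) < -((O1 + a₁ C / (1 - (C.L ^ 3)⁻¹) + 1) / (d₀ * s₀)) := by
    have := Real.log_lt_log hg0 hg
    rwa [Real.log_exp] at this
  have hmul := mul_lt_mul_of_pos_left hlt hc
  have hkey : d₀ * s₀ * -((O1 + a₁ C / (1 - (C.L ^ 3)⁻¹) + 1) / (d₀ * s₀))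
      = -(O1 + a₁ C / (1 - (C.L ^ 3)⁻¹) + 1) := by
    field_simp
  rw [Real.log_inv] at hO
  linarith

/-- **The DAG leaf's conjunction fails on such a family**: `¬ (B10.Thm1Printed runs ∧ B10.Thm2Printed runs)` — the
literal shape of the cell's `DagBinding.RefBinding.b10 := B10.Thm1Printed X.runs10 ∧ B10.Thm2Printed X.runs10` (not
imported here).  Immediate from `not_thm1Printed_of_leafSystems`. [folklore] -/
theorem not_dagLeaf_b10_of_leafSystems (T : I → TowerRun) (S : ∀ i, LeafSystem C (T i)) {d₀ s₀ : ℝ}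
    (hd : 0 < d₀) (hs : 0 < s₀) (hU : ∀ i, UnitConfig0 (T i)) (hS : ∀ i, StarLower (S i) s₀)
    (hD : ∀ i, DgLower (S i) d₀) (hsmall : SmallBareOccur T) :
    ¬ (Thm1Printed (fun i => (T i).toRunData) ∧ Thm2Printed (fun i => (T i).toRunData)) :=
  fun h => not_thm1Printed_of_leafSystems T S hd hs hU hS hD hsmall h.1

/-- **What the leaf system DOES and DOES NOT deliver, side by side**: for such a family,
`(B10.Thm1PrintedCompact ∧ B10.Thm2Printed) ∧ ¬ B10.Thm1Printed` — gen 1's `B10Assembly.thm1Compact_and_thm2_of_leafSystem`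
(Theorem 1 in the audit reading + Theorem 2) together with `not_thm1Printed_of_leafSystems`. [folklore] -/
theorem compact_thm2_not_thm1Printed (T : I → TowerRun) (S : ∀ i, LeafSystem C (T i)) {d₀ s₀ : ℝ}
    (hd : 0 < d₀) (hs : 0 < s₀) (hU : ∀ i, UnitConfig0 (T i)) (hS : ∀ i, StarLower (S i) s₀)
    (hD : ∀ i, DgLower (S i) d₀) (hsmall : SmallBareOccur T) :
    (Thm1PrintedCompact (fun i => (T i).toRunData) ∧ Thm2Printed (fun i => (T i).toRunData))
      ∧ ¬ Thm1Printed (fun i => (T i).toRunData) :=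
  ⟨thm1Compact_and_thm2_of_leafSystem T S, not_thm1Printed_of_leafSystems T S hd hs hU hS hD hsmall⟩

/-- The fine-lattice form of `not_thm1Printed_of_leafSystems` (hypothesis `FineLattices S` instead of
`SmallBareOccur T`). [folklore] -/
theorem not_thm1Printed_of_fineLattices (T : I → TowerRun) (S : ∀ i, LeafSystem C (T i)) {d₀ s₀ : ℝ}
    (hd : 0 < d₀) (hs : 0 < s₀) (hU : ∀ i, UnitConfig0 (T i)) (hS : ∀ i, StarLower (S i) s₀)
    (hD : ∀ i, DgLower (S i) d₀) (hfine : FineLattices S) :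
    ¬ Thm1Printed (fun i => (T i).toRunData) :=
  not_thm1Printed_of_leafSystems T S hd hs hU hS hD (smallBare_of_fineLattices S hfine)

end Families

/-! ## §5. The separation witnessed: a LeafSystem family with d(𝔤) = 3, (62), (64), ρ_k ≡ e^{−E_k} -/

section Witness

/-- Family constants of the logarithmic model: those of `B10Assembly.trivConsts` (g = 1, L = 2, κ₀ = 1/4, p₀ = 1,
M₁ = b₀ = 0, every O(1) = 0) except `dg = 3` (= d(su(2))). [folklore] -/
noncomputable def logConsts : B10Assembly.Consts where
  g := 1
  L := 2
  κ₀ := 1 / 4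
  M₁ := 0
  b₀ := 0
  p₀ := 1
  C46 := 0
  σmax := 0
  dg := 3
  z := 0
  aP := 0
  rstar := 0
  d := 0
  g_pos := one_pos
  one_lt_L := by norm_num
  κ₀_pos := by norm_num
  M₁_nonneg := le_rfl
  p₀_pos := one_pos
  C46_nonneg := le_rfl
  σmax_nonneg := le_rfl
  dg_nonneg := by norm_num
  z_nonneg := le_rfl
  aP_nonneg := le_rfl
  rstar_nonneg := le_rfl
  d_nonneg := le_rfl

/-- The spacing of the depth-K model run: ε = 2^{−K}. [folklore] -/
noncomputable def logEps (K : ℕ) : ℝ := ((2 : ℝ) ^ K)⁻¹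

/-- E^{(k)} of the model by (62) with log σ₀ = log Z = Σ𝒫′ = 0, d(𝔤) = 3, |T₁^{(k)*}| = (7/4)|T₁^{(k)}|:
`E^{(k)} = 3·log g_k·(7/4)|T₁^{(k)}|`. [folklore] -/
noncomputable def logEstep (K k : ℕ) : ℝ :=
  3 * Real.log (gRun 1 2 (logEps K) k) * (7 / 4 * sitesRun 2 (logEps K) 1 k)

/-- E_k of the model by (64): `E_k = Σ_{j=k}^{K−1} E^{(j)}`. [folklore] -/
noncomputable def logEcst (K k : ℕ) : ℝ := ∑ j ∈ Finset.Ico k K, logEstep K j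

/-- The logarithmic model run of depth K on spacing 2^{−K}: one configuration and one history per scale, χ ≡ 1, all
actions / interactions / Z-terms / remainders 0, the history functional `F ↦ exp F(·)`, the carrier scaling
g_k = (2^kε)^{1/2}, |T₁^{(k)}| = (2^kε)^{−3}, the counterterms E^{(k)}, E_k of (62), (64) (`logEstep`, `logEcst`) and
**ρ_k ≡ exp(−E_k)** (so that (41), (47), (22)/(55) hold with equality).  A consistency witness for the typing, nothing
about gauge theory. [folklore] -/
noncomputable def logRun (K : ℕ) : TowerRun where
  K := K
  Cfg := fun _ => Unit
  ρ := fun k _ => Real.exp (-logEcst K k)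
  χ := fun _ _ => 1
  wilsonBG := fun _ _ => 0
  sites := sitesRun 2 (logEps K) 1
  g := gRun 1 2 (logEps K)
  Ineq41_47 := fun _ => True
  Hist := fun _ => Unit
  triv := fun _ => ()
  LF := fun _ _ F => Real.exp (F ())
  lf_mono := fun _ _ F G hFG => Real.exp_le_exp.mpr (hFG ())
  lf_shift := fun _ _ F t => by
    show Real.exp (F () + t) = Real.exp t * Real.exp (F ())
    rw [Real.exp_add, mul_comm]
  mainT := fun _ _ _ => 0
  mainT_triv := fun _ _ => by simp
  Pint := fun _ _ _ => 0
  Λvol := fun _ _ => 0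
  Λvol_le := fun k _ => sitesRun_nonneg 2 _ 1 (by norm_num) (by unfold logEps; positivity) zero_le_one k
  Zterm := fun _ _ => 0
  Zterm_triv := fun _ => rfl
  Ecst := logEcst K
  Estep := logEstep K
  Ecst_eq := fun _ => rfl
  Rm := fun _ => 0
  χ_nonneg := fun _ _ => zero_le_one
  sites_nonneg := fun k => sitesRun_nonneg 2 _ 1 (by norm_num) (by unfold logEps; positivity) zero_le_one k
  M₁ := 0
  b₀ := 0
  p₀ := 1

/-- The step pieces of the model: d(𝔤) = 3, |B*| = |T*| = (7/4)|T₁^{(k)}|, everything else 0, the remainder unit the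
carrier's (2^kε)^{3+¼}|T₁^{(k)}|. [folklore] -/
noncomputable def logPieces (K k : ℕ) : StepPieces (logRun K) k where
  proj := fun _ => ()
  proj_triv := rfl
  Zvol := fun _ => 0
  Zvol_nonneg := fun _ => le_rfl
  Zvol_triv := rfl
  starB := fun _ => 7 / 4 * sitesRun 2 (logEps K) 1 k
  starT := 7 / 4 * sitesRun 2 (logEps K) 1 k
  logσ₀ := 0
  dg := 3
  dg_nonneg := by norm_num
  logZU := fun _ _ => 0
  logZ1 := fun _ => 0
  logZT := 0
  logFl := fun _ _ => 0
  PprU := fun _ _ => 0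
  Ppr1 := fun _ => 0
  PprT := 0
  PY := fun _ _ => 0
  PYZ := fun _ _ => 0
  Pold := fun _ _ => 0
  PoldIn := fun _ _ => 0
  rem := ((2 : ℝ) ^ k * logEps K) ^ ((3 : ℝ) + 1 / 4) * sitesRun 2 (logEps K) 1 k
  rem_nonneg := mul_nonneg (Real.rpow_nonneg (by unfold logEps; positivity) _)
    (sitesRun_nonneg 2 _ 1 (by norm_num) (by unfold logEps; positivity) zero_le_one k)

/-- (64) one step down in the model: `E_k = E^{(k)} + E_{k+1}` for k < K. [folklore] -/
theorem logEcst_succ {K k : ℕ} (hk : k + 1 ≤ K) : logEcst K k = logEstep K k + logEcst K (k + 1) := by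
  unfold logEcst
  rw [Finset.sum_eq_sum_Ico_succ_bot (by omega : k < K)]

/-- The fourteen step leaves hold in the model at every step k < K with all constants 0 ((22)/(55) and their lower
forms with EQUALITY: ρ_{k+1} = exp(−E_k + E^{(k)}) = exp(−E_{k+1})). [folklore] -/
noncomputable def logLeaves (K k : ℕ) (hk : k + 1 ≤ K) : StepLeaves (logRun K) k where
  P := logPieces K k
  Cz := 0
  C₁ := 0
  C₁' := 0
  C₂ := 0
  Cv := 0
  C₃ := 0
  C₄ := 0
  C₅ := 0
  c₁ := 0
  C₆ := 0
  bound55 := fun _ U => by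
    show Real.exp (-logEcst K (k + 1)) ≤ Real.exp _
    apply Real.exp_le_exp.mpr
    simp only [logRun, logPieces, logEcst_succ hk, logEstep]
    ring_nf
    exact le_rfl
  bound55Lower := fun _ U => by
    show (1 : ℝ) * Real.exp _ ≤ Real.exp (-logEcst K (k + 1))
    rw [one_mul]
    apply Real.exp_le_exp.mpr
    simp only [logRun, logPieces, logEcst_succ hk, logEstep]
    ring_nf
    exact le_rfl
  cumulant58 := fun h U => by simp [logRun, logPieces]
  cumulantLower := fun U => by simp [logRun, logPieces]
  repr33_60 := fun h U => by simp [logPieces]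
  vacuumWhole := fun h => by simp [logRun, logPieces]
  decomp35_61 := fun h U => by simp [logPieces]
  norm35 := fun h => by simp [logPieces]
  starCount := fun h => by simp [logPieces]
  oldOutside := fun h U => by simp [logPieces]
  pintSucc := fun h U => by simp [logRun, logPieces]
  estep62 := by
    show logEstep K k = _
    simp only [logRun, logPieces, logEstep]
    ring
  ztermSucc := fun h => by simp [logRun, logPieces]
  rmSucc := by simp [RmSucc, logRun, logPieces]

/-- Elementary: `2^k·2^{−K} ≤ 1` for k ≤ K (= `B10Assembly.two_pow_mul_inv_le_one`, restated on `logEps`). [folklore] -/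
theorem scale_le_one_log {K k : ℕ} (hk : k ≤ K) : (2 : ℝ) ^ k * logEps K ≤ 1 :=
  two_pow_mul_inv_le_one hk

/-- **The model run carries a leaf system for `logConsts`, at every depth K.** [folklore] -/
noncomputable def logLeafSystem (K : ℕ) : LeafSystem logConsts (logRun K) where
  ε := logEps K
  Tε := 1
  ε_pos := by unfold logEps; positivity
  Tε_nonneg := zero_le_one
  g_eq := fun _ => rfl
  sites_eq := fun _ => rfl
  scale_le_one := fun k hk => scale_le_one_log hk
  g_le_one := fun k hk => by
    show 1 * Real.sqrt ((2 : ℝ) ^ k * logEps K) ≤ 1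
    rw [one_mul]
    calc Real.sqrt ((2 : ℝ) ^ k * logEps K) ≤ Real.sqrt 1 := Real.sqrt_le_sqrt (scale_le_one_log hk)
      _ = 1 := Real.sqrt_one
  par := ⟨rfl, rfl, rfl⟩
  spec := fun k => ⟨fun _ => ⟨fun U => by simp [logRun], fun U => by simp [logRun]⟩, fun _ => trivial⟩
  step0 := ⟨fun U => by simp [logRun], fun U => by simp [logRun]⟩
  noInt0 := fun _ _ => rfl
  steps := fun k hk => logLeaves K k hk
  Λvol_nonneg := fun _ _ => le_rfl
  bound46 := fun k _ _ h U => by simp [logRun, logConsts]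
  starT_nonneg := fun k _ => by
    show (0 : ℝ) ≤ 7 / 4 * sitesRun 2 (logEps K) 1 k
    exact mul_nonneg (by norm_num) ((logRun K).sites_nonneg k)
  starT_le := fun k _ => by
    have h0 : (0 : ℝ) ≤ sitesRun 2 (logEps K) 1 k := (logRun K).sites_nonneg k
    show 7 / 4 * sitesRun 2 (logEps K) 1 k ≤ 3 * sitesRun 2 (logEps K) 1 k
    nlinarith
  logσ₀_le := fun _ _ => by simp [logPieces, logLeaves, logConsts]
  dg_le := fun _ _ => le_rfl
  logZT_le := fun _ _ => by simp [logPieces, logLeaves, logConsts]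
  PprT_le := fun _ _ => by simp [logPieces, logLeaves, logConsts]
  rem_eq := fun k _ => by
    show ((2 : ℝ) ^ k * logEps K) ^ ((3 : ℝ) + 1 / 4) * sitesRun 2 (logEps K) 1 k = _
    rfl
  Rm_zero := le_rfl
  Rm_succ_le := fun k _ => by simp [logRun, logConsts]
  lf := fun k _ U => by simp [logRun, logConsts]

/-- (R1) in the model: the single configuration has A = 0, χ = 1. [folklore] -/
theorem logRun_unitConfig (K : ℕ) : UnitConfig0 (logRun K) := ⟨(), rfl, rfl⟩

/-- (R2) in the model with s₀ = 7/4 = 2(1 − 2⁻³). [folklore] -/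
theorem logRun_starLower (K : ℕ) : StarLower (logLeafSystem K) (7 / 4) := fun _ _ => le_rfl

/-- (R3) in the model with d₀ = 3. [folklore] -/
theorem logRun_dgLower (K : ℕ) : DgLower (logLeafSystem K) 3 := fun _ _ => le_rfl

/-- Small bare couplings occur in the model family: g₀ = 2^{−K/2} → 0, |T₁^{(0)}| = 8^K > 0, K ≥ 1. [folklore] -/
theorem logRun_smallBare : SmallBareOccur (fun K : ℕ => logRun K) := by
  intro δ hδ
  obtain ⟨n, hn⟩ := exists_pow_lt_of_lt_one (pow_pos hδ 2) (by norm_num : (1 / 2 : ℝ) < 1)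
  refine ⟨n + 1, by simp [logRun], ?_, ?_⟩
  · show 0 < sitesRun 2 (logEps (n + 1)) 1 0
    unfold sitesRun logEps
    positivity
  · show gRun 1 2 (logEps (n + 1)) 0 < δ
    unfold gRun logEps
    rw [pow_zero, one_mul, one_mul]
    have hle : ((2 : ℝ) ^ (n + 1))⁻¹ ≤ (1 / 2 : ℝ) ^ n := by
      rw [one_div, inv_pow, pow_succ, mul_inv]
      have h2 : 0 < ((2 : ℝ) ^ n)⁻¹ := by positivity
      nlinarith
    calc Real.sqrt (((2 : ℝ) ^ (n + 1))⁻¹) ≤ Real.sqrt ((1 / 2 : ℝ) ^ n) := Real.sqrt_le_sqrt hle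
      _ < Real.sqrt (δ ^ 2) := Real.sqrt_lt_sqrt (by positivity) hn
      _ = δ := Real.sqrt_sq hδ.le

/-- **¬ `B10.Thm1Printed` on the model family** (by `not_thm1Printed_of_leafSystems` with d₀ = 3, s₀ = 7/4).
[folklore] -/
theorem not_thm1Printed_logRun : ¬ Thm1Printed (fun K : ℕ => (logRun K).toRunData) :=
  not_thm1Printed_of_leafSystems (fun K => logRun K) (fun K => logLeafSystem K)
    (by norm_num : (0 : ℝ) < 3) (by norm_num : (0 : ℝ) < 7 / 4) logRun_unitConfig logRun_starLower logRun_dgLower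
    logRun_smallBare

/-- … while `B10.Thm1PrintedCompact ∧ B10.Thm2Printed` holds on it (gen 1's assembly theorem). [folklore] -/
theorem logRun_compact_and_thm2 :
    Thm1PrintedCompact (fun K : ℕ => (logRun K).toRunData) ∧ Thm2Printed (fun K : ℕ => (logRun K).toRunData) :=
  thm1Compact_and_thm2_of_leafSystem (fun K => logRun K) (fun K => logLeafSystem K)

/-- **THE SEPARATION, UNCONDITIONAL**: there is a family of runs, each carrying a leaf system for common constants and
with couplings in (0, 1], on which `B10.Thm1PrintedCompact ∧ B10.Thm2Printed` holds and `B10.Thm1Printed` fails.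
So the first conjunct of the DAG leaf `b10` is NOT a consequence of the hypothesis bundle under which the cell derived
the paper (`B10Assembly.LeafSystem`), whereas its audit reading is.  A statement about the typing. [folklore] -/
theorem logRun_separation :
    ∃ (C : B10Assembly.Consts) (I : Type) (T : I → TowerRun),
      (∀ i, Nonempty (LeafSystem C (T i))) ∧ (∀ i k, k ≤ (T i).K → 0 < (T i).g k ∧ (T i).g k ≤ 1)
        ∧ Thm1PrintedCompact (fun i => (T i).toRunData) ∧ Thm2Printed (fun i => (T i).toRunData)
        ∧ ¬ Thm1Printed (fun i => (T i).toRunData) :=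
  ⟨logConsts, ℕ, fun K => logRun K, fun K => ⟨logLeafSystem K⟩,
    fun K k hk => ⟨(logLeafSystem K).g_pos k, (logLeafSystem K).g_le_one k hk⟩,
    logRun_compact_and_thm2.1, logRun_compact_and_thm2.2, not_thm1Printed_logRun⟩

/-- Corollary: "leaf systems with common constants ⇒ `B10.Thm1Printed`" is FALSE (contrast
`B10Assembly.thm1Compact_and_thm2_of_leafSystem`). [folklore] -/
theorem leafSystems_not_thm1Printed :
    ¬ ∀ (C : B10Assembly.Consts) (I : Type) (T : I → TowerRun), (∀ i, LeafSystem C (T i)) →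
        Thm1Printed (fun i => (T i).toRunData) :=
  fun h => not_thm1Printed_logRun (h logConsts ℕ (fun K => logRun K) (fun K => logLeafSystem K))

/-- Corollary: the converse of `B10.thm1Compact_of_thm1Printed` fails — `Thm1PrintedCompact` does not imply
`Thm1Printed`, even for families with couplings in (0, 1] (the docstring of `B10.Thm1PrintedCompact` said so in prose;
here by the model family). [folklore] -/
theorem not_thm1Printed_of_thm1Compact :
    ¬ ∀ (I : Type) (runs : I → RunData), (∀ i k, k ≤ (runs i).K → 0 < (runs i).g k ∧ (runs i).g k ≤ 1) →
        Thm1PrintedCompact runs → Thm1Printed runs :=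
  fun h => not_thm1Printed_logRun (h ℕ (fun K => (logRun K).toRunData)
    (fun K k hk => ⟨(logLeafSystem K).g_pos k, (logLeafSystem K).g_le_one k hk⟩) logRun_compact_and_thm2.1)

end Witness

end B10DagLeaf

end Literature.MathematicalPhysics.QuantumFieldTheory.Balaban1983to89
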